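import Literature.MathematicalPhysics.QuantumFieldTheory.Balaban1983to89.B8Prop5UniqSectEW
import Literature.MathematicalPhysics.QuantumFieldTheory.Balaban1983to89.B8Prop5WitnessOfDatum
import Literature.MathematicalPhysics.QuantumFieldTheory.Balaban1983to89.B8SockP5uEWindows
import Literature.MathematicalPhysics.QuantumFieldTheory.Balaban1983to89.B8Prop5SocketDatum
import Literature.MathematicalPhysics.QuantumFieldTheory.Balaban1983to89.B8Prop5ExistsZdLan

/-!
# `Balaban1983to89.B8Prop5UniqueZdLan` — [Balaban1985RegularSpaces] PROPOSITION 5, THE UNIQUENESS CLAUSE (1.109) p. 94, AS PRINTED, AT THE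
# MEMBER OF RECORD `zdLan` (`B8Prop5LandauDataZd`, seat `lit-balaban-type-B8`): `B8.Prop5Unique (zdLan L B₁ ∘ ι)` over any index map `ι` into the
# `Ω 0 = ℤᵈ` members with antitone regions and towers inside `Ω_j`, MODULO [4]'s uniqueness letters at every member (left-inverse law of `G′` on
# bounded functions — the W8″ guard)

statement-level skeleton of published theorems with citation tags; proofs where landed; nothing here is a claim about the
Yang–Mills mass gap

PDF held: `paper:balaban1985-cmp99-regular-spaces-gauge-fixing` (journal page = PDF page + 74); Prop. 5 p. 94 [PDF 20], pp. 88–89 ((1.68)–(1.69),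
(1.73)–(1.74)), p. 93 (1.102), pp. 95–97 (Sect. E).  [3] = [Balaban1985Averaging] ((166)–(167) p. 44, Prop. 10 p. 50); [4] =
[Balaban1985BackgroundPropagators] (Thm 3.1 p. 397, (3.25) p. 394, Thms 3.2–3.3 pp. 397–398).

> p. 94 [PDF 20]: «**Proposition 5.** There exist positive constants c₂, c₃, depending on d and L only, such that for an arbitrary configuration U₁
> satisfying (1.69), and for the configuration u₁ determined by U₁ and satisfying (1.68), (1.73), (1.74), if α₀ + α₁ ≦ c₂, then there exists a
> configuration u′ = e^{iλ} satisfying the equations (1.107) and the bounds (1.108).  Such a configuration u′ is unique in the domain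
> |λ|, |Dλ|₍₋₁₎ < c₃.  (1.109)»

WHY THIS FILE (cell `pub-ymgap`, HUMAN RULING D-0062; R134 acceleration seat `pub-ymgap-dag-n05-d` (g3) — the UNIQUENESS twin of the LOCATED row (L1)
«Proposition 5 AS PRINTED at `zdLan`»; the existence twin `B8.Prop5Exists … (zdLan …)` is seat `pub-ymgap-dag-n05-c` g3's `B8Prop5ExistsZdLan`).  The N05
knit's leaf conjunct `p5u : B8.Prop5Unique lan` is over an ABSTRACT family `lan`, and the record's `ResidB8.lan` is residual data; the honest member is
lit-balaban's `zdLan L B₁ i` (datum `(u₁, A)`, `U₁ = e^{iηA}`, hypothesis (1.33) ∧ (1.69) ∧ (1.68) ∧ (1.73)–(1.74), parameters `λ` Hermitian `= 0` off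
`Ω₀` and bounded, norm `max(|λ|, |Dλ|₍₋₁₎)`, equations (1.107) = Landau-of-record for `U₁^{(e^{iλ})⁻¹}` ∧ (1.29) for `u₁e^{iλ}`).  THIS FILE proves
**`prop5Unique_zdLan_of_lettersUB`**: for every index map `ι : J → ZdLanIdx d 𝔸` into members with `Ω 0 = ℤᵈ`, antitone `{Ω_j}` and the towers of
`Λ_j` inside `Ω_j`, GIVEN at every `ι j` the uniqueness letters of [4] at `(k, Λ, U₀)` — `G′, Δ, Q′, Q′ᵀ, 𝔄, C, H′` with the twelve laws of the knit's
`SLetU` family EXCEPT that the left-inverse law of `G′` is asked on BOUNDED functions only (`g_leftB`, [4] Thm 3.1 p. 397 as printed; the total law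
has no model on `ℤᵈ → 𝔸`, INBOX W8″) — print's uniqueness clause `B8.Prop5Unique (fun j => zdLan L B₁ (ι j))` HOLDS, with ONE threshold
`c₂ = min(c_P, c_L)` and ONE radius `c₃ = c_u/L` for the whole family (`α₄, c_u, c_P` from n04-b's `B8SockP5uEWindows.uniqWindows_of_guard` at
`B₀ := max(B₁, 2)/(5dL)`).  PROOF = the uniqueness JOIN at print's generality `B8Prop5UniqSectEW.hFP_unique_of_sectE_local_wb` fed, at the member,
by: the Λ_j-witnesses of p. 89 from `(1.68), (1.73), (1.74)` (n05-c's `B8Prop5WitnessOfDatum.hwit_unitary_of_datum`, class constant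
`40·d·c_B ≥ max(16d, 4dL)·B₁(α₀+α₁)`); (1.29) from (1.68) (`restr129_of_hyp169`); the source `D*A` and the sizes of `A` from (1.69) ITSELF
(n05-c's `B8Prop5ExistsZdLan.hA_of_cond169` / `bd2_covDivB_of_cond169` BY NAME — print's gradient member of (1.69) makes Prop. 3 / the b9
socket unnecessary here); the bond
classes `Eb j := {b ∣ b touches Ω_j}` (print's «|Dλ|₍₋₁₎ on Ω_j», on which the letters' `SideTouches` laws restrict); each competitor's
multiplier clause READ OFF its Landau condition of record by the D*-identity `B8Prop5KLevelLetters.covDivB_logCfg_gaugeFixed`; and the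
dictionary `B8Prop5LandauDataZd.norm_lt_of_lamNorm_lt` ((1.109) ⇒ pointwise; the top level `k` costs ONE factor `L`, whence `c₃ = c_u/L`).

HONEST SCOPE.  Assembly over landed modules; [4]'s letters are HYPOTHESES at every member (nothing of [4] Thms 3.1–3.3, of Sect. E or of the
contraction is proved here beyond composition); constants are the lineage's, sufficient only; `c₂, c₃` depend on `d, L, B₁` and the displayed
letters' constants (print: «on d and L only» — [4]'s constants are themselves functions of `d, L`).  Count-neutral; N05 NOT discharged; one finite
T⁴ programme at fixed ε; nothing continuum / ℝ⁴ / OS / mass-gap / Clay.  No `sorry`, no `def`, no `instance`, no `notation`.  Unit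
`pub-ymgap-dag-n05-d` (g3), 2026-08-27.  Tree API by name only, nothing restated.
-/

noncomputable section

open NormedSpace
open scoped BigOperators

namespace Literature.MathematicalPhysics.QuantumFieldTheory.Balaban1983to89.B8Prop5UniqueZdLan

open Complex (I)
open B7Prop1Explicit B7Prop2Explicit B7Prop1Local B7Eq92Concrete
open B7Prop2Explicit (C0 c2')
open B7Prop10General (C6 C4G)
open B7Prop9Flat (C5')
open B7Eq78Linearization (conjR zdBlocking QprimeIter)
open B7Eq167Flat (InLambda)
open B8Ineq132 (covDerivFwd covDeriv InAk BondTouches norm_conjR)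
open B8Eq119TwistedAxial (Restr129 bgT)
open B8Eq184Proof (gaugeExp cfgExp)
open B8Eq182Proof (gAd)
open B8Eq188Proof (frakF3)
open B8Eq140Level (SideTouches sideTouches_of_bondTouches)
open B8Ineq130 (tlo thi)
open B8Eq138LandauZd (IsLandau138W covDivB covLap QT logCfg)
open B8Ineq125Concrete (C2p)
open B8Eq1117Concrete (XSpace)
open B8Eq178Averages (Cond168 Cond169)
open B8Prop5ContractionKLevel (Bd2 Mc Kc)
open B8LambdaSpaceKLevel (wt wt_nonneg wt_pos)
open B8Prop5GaugeParamKLevel (norm_covDeriv_eq)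
open B8Prop5KLevelLetters (covDivB_logCfg_gaugeFixed)
open B8Thm4AtLandau138 (pdevOn_tower_lt_of_inAk)
open B8SockP5uEWindows (uniqWindows_of_guard)
open B8Prop5LandauDataZd (Cond7374 ZdLanIdx zdLan norm_lt_of_lamNorm_lt)
open B8Prop5WitnessOfDatum (hwit_unitary_of_datum restr129_of_hyp169)
open B8Prop5ExistsZdLan (hA_of_cond169 bd2_covDivB_of_cond169)
open B8Prop5UniqSectEW (hFP_unique_of_sectE_local_wb)

-- `Site` alone could resolve to the torus sites of `Setup.lean`; re-export the `ℤ^d` sites of `B7Prop1Explicit`.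
export B7Prop1Explicit (Site)

variable {d : ℕ}

/-! ## §1 The Λ_j-witnesses of p. 89 at the member, with a class constant above `max(16d, 4dL)·B₁(α₀ + α₁)` -/

section Witness

variable {𝔸 : Type} [CStarAlgebra 𝔸] [Nontrivial 𝔸]

omit [Nontrivial 𝔸] in
/-- **«(1.73), (1.74) together with R₀ū₁ʲ = 1 on Λ_j imply that u₁ satisfies (166), (167) [3] on Bʲ(Λ_j)»** (p. 89) AT THE MEMBER, FOR ANY CLASS
CONSTANT `α₃ ≥ 16dB₁(α₀+α₁)` with `L·4dB₁(α₀+α₁) ≤ α₃` — n05-c's `B8Prop5WitnessOfDatum.hwit_unitary_of_datum` read off `zdLan`'s `Hyp169`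
(`hwit_of_hyp169` is the same at `α₃ = 16dLB₁(α₀+α₁)`): at every `(j, y ∈ Λ_j)`, `j ≤ k`, a UNITARY global `ũ ∈ Λ_j(π^*U₀, α₃)` agreeing with
`u₁` on `Bʲ(y)`. [cite: Balaban1985RegularSpaces, p.89 (after (1.76)), (1.68) p.88, (1.73)–(1.74) pp.88–89; Balaban1985Averaging, (166)–(167) p.44] -/
theorem hwit_unitary_of_hyp169 {L : ℕ} (hL : 1 ≤ L) {B₁ : ℝ} (hB₁ : 0 ≤ B₁) (i : ZdLanIdx d 𝔸) {α₀ α₁ α₃ : ℝ} (hα : 0 ≤ α₀ + α₁)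
    (ha : 16 * (d : ℝ) * B₁ * (α₀ + α₁) ≤ α₃) (hLb : (L : ℝ) * (4 * d * B₁ * (α₀ + α₁)) ≤ α₃)
    {p : (zdLan L B₁ i).Cfg} (h : (zdLan L B₁ i).Hyp169 α₀ α₁ p) :
    ∀ j, j ≤ i.k → ∀ y ∈ i.Λ j, ∃ ut : Site d → 𝔸ˣ, (∀ x, ut x ∈ unitaryUnits 𝔸) ∧
      InLambda L (clampCfg (tlo L y j) (thi L y j) i.U₀) ut j α₃ (((L : ℝ) ^ j)⁻¹) ∧
      ∀ x : Site d, tlo L y j ≤ x → x ≤ thi L y j → p.1.1 x = ut x := by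
  obtain ⟨-, -, h68, h74⟩ := h
  obtain ⟨k, hk⟩ : ∃ k, i.k = k + 1 := ⟨i.k - 1, (Nat.sub_add_cancel i.hk).symm⟩
  have ek : i.k - 1 = k := by omega
  rw [ek] at h68
  rw [hk] at h74 ⊢
  have hb : (0 : ℝ) ≤ 4 * d * B₁ * (α₀ + α₁) := by positivity
  exact hwit_unitary_of_datum hL p.2.1 h68 h74 ha hb hLb

end Witness

/-! ## §2 Proposition 5's uniqueness clause (1.109) AS PRINTED at `zdLan`, over any index map into the `Ω 0 = ℤᵈ` members -/

section Main

variable {𝔸 : Type} [CStarAlgebra 𝔸] [Nontrivial 𝔸]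

/-- **PROPOSITION 5, UNIQUENESS CLAUSE (1.109) AS PRINTED, AT THE MEMBER OF RECORD — `B8.Prop5Unique (zdLan L B₁ ∘ ι)` MODULO [4]'s UNIQUENESS
LETTERS.**  For `d, L ≥ 2`, `B₁ ≥ 0`, letters' constants `B₀′_H > 0`, `B₂′, B_G, B_R ≥ 0`, regularity threshold `c_L > 0`, and an index map
`ι : J → ZdLanIdx d 𝔸` into members with `Ω 0 = ℤᵈ`, antitone `{Ω_j}` and the towers `Bʲ(Λ_j) ⊂ Ω_j`: IF at every `ι j`, for every regularity
`α₀ ≤ c_L` with `U₀ ∈ 𝔄_k({Ω_j}, α₀)`, there are `ℂ`-linear letters `g = G′`, `Δ`, `q = Q′`, `qs = Q′ᵀ`, `Aw = 𝔄`, `c = C`, `H′` at `(k, Λ, U₀)` with the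
twelve laws of the knit's uniqueness family — **the left-inverse law of `G′` for BOUNDED inputs** («`G′(Δ + Q′ᵀ𝔄Q′)x = x` whenever `sup |x| < ∞`»,
[4] Thm 3.1), the left inverse of `C` in range form, the readings of `Δ`, `Q′ᵀ`, `Q′` (zero off the structure), (1.92) for `H′` (sup, gradient on
the sides touching `Ω_j`, Laplacian), (1.91) `Q′H′ = I`, (1.101) for `G′`, (1.98) for `R` — THEN print's uniqueness clause holds on the family
`fun j => zdLan L B₁ (ι j)`: there are `c₂, c₃ > 0` such that at every member, for every `α₀ + α₁ ≤ c₂` and every datum `(u₁, A)` with (1.33),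
(1.69), (1.68), (1.73)–(1.74), two parameters `λ₁, λ₂` solving (1.107) with `|λᵢ|, |Dλᵢ|₍₋₁₎ < c₃` COINCIDE.  (`c₂ = min(c_P, c_L)`, `c₃ = c_u/L` with
`α₄, c_u, c_P` of `B8SockP5uEWindows.uniqWindows_of_guard` at `B₀ = max(B₁, 2)/(5dL)`.)
[cite: Balaban1985RegularSpaces, Prop. 5 (1.109) p.94, p.89 (after (1.76)), (1.68)–(1.69) p.88, (1.102) p.93, (1.112)–(1.121) pp.95–97; Balaban1985Averaging, Prop. 10 p.50;
Balaban1985BackgroundPropagators, Thm 3.1 p.397, (3.25) p.394, Thms 3.2–3.3 pp.397–398] -/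
theorem prop5Unique_zdLan_of_lettersUB (hd2 : 2 ≤ d) {L : ℕ} (hL : 2 ≤ L) {B₁ B₀'H B₂' BG BR cL : ℝ} (hB₁ : 0 ≤ B₁)
    (hB₀'H : 0 < B₀'H) (hB₂' : 0 ≤ B₂') (hBG : 0 ≤ BG) (hBR : 0 ≤ BR) (hcL : 0 < cL)
    {J : Type} (ι : J → ZdLanIdx d 𝔸) (hΩ0 : ∀ j, (ι j).Ω 0 = Set.univ) (hΩ : ∀ j n, (ι j).Ω (n + 1) ⊆ (ι j).Ω n)
    (htower : ∀ j, ∀ n, n ≤ (ι j).k → ∀ y ∈ (ι j).Λ n, ∀ x, InBox (tlo L y n) (thi L y n) x → x ∈ (ι j).Ω n)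
    -- [4]'s uniqueness letters at every member, left-inverse law of G′ on bounded functions
    (SLetUB : ∀ j : J, ∀ α₀ : ℝ, 0 < α₀ → α₀ ≤ cL → InAk L (ι j).k (ι j).η α₀ (ι j).Ω (ι j).U₀ →
      ∃ (g Δ : (Site d → 𝔸) →ₗ[ℂ] (Site d → 𝔸)) (q : (Site d → 𝔸) →ₗ[ℂ] (ℕ → Site d → 𝔸)) (qs : (ℕ → Site d → 𝔸) →ₗ[ℂ] (Site d → 𝔸))
        (Aw c : (ℕ → Site d → 𝔸) →ₗ[ℂ] (ℕ → Site d → 𝔸)) (H' : XSpace d (ι j).k 𝔸 →ₗ[ℂ] (Site d → 𝔸)),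
        (∀ x : Site d → 𝔸, (∃ C : ℝ, ∀ y, ‖x y‖ ≤ C) → g (Δ x + qs (Aw (q x))) = x) ∧ (∀ φ, qs (c (q (g (g (qs φ))))) = qs φ) ∧
        (∀ (f : Site d → 𝔸), ∀ x ∈ (ι j).Ω 0, Δ f x = covLap (ι j).η (ι j).U₀ (((ι j).Ω 0).indicator f) x) ∧
        (∀ (μ : ℕ → Site d → 𝔸), ∀ x ∈ (ι j).Ω 0, qs μ x = QT L (ι j).k (ι j).Λ (ι j).U₀ μ x) ∧
        (∀ (f : Site d → 𝔸) (n : ℕ), n ≤ (ι j).k → ∀ y ∈ (ι j).Λ n, q f n y = QprimeIter (zdBlocking d L) (bgT L (ι j).U₀) n f y) ∧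
        (∀ (f : Site d → 𝔸) (n : ℕ) (y : Site d), ¬ (n ≤ (ι j).k ∧ y ∈ (ι j).Λ n) → q f n y = 0) ∧
        (∀ (X : XSpace d (ι j).k 𝔸) (x : Site d), ‖H' X x‖ ≤ B₀'H * ‖X‖) ∧
        (∀ n, n ≤ (ι j).k → ∀ (X : XSpace d (ι j).k 𝔸), ∀ p ∈ {b : Site d × Fin d | SideTouches ((ι j).Ω n) b.1 b.2},
          wt L (ι j).η n * ‖covDerivFwd (ι j).η (ι j).U₀ p.2 (H' X) p.1‖ ≤ B₀'H * ‖X‖) ∧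
        (∀ X : XSpace d (ι j).k 𝔸, Bd2 L (ι j).η (ι j).k (ι j).Ω (covLap (ι j).η (ι j).U₀ (H' X)) (B₂' * ‖X‖)) ∧
        (∀ (Y : XSpace d (ι j).k 𝔸) (n : ℕ) (hn : n ≤ (ι j).k) (y : Site d), y ∈ (ι j).Λ n →
          QprimeIter (zdBlocking d L) (bgT L (ι j).U₀) n (H' Y) y = Y (⟨n, Nat.lt_succ_of_le hn⟩, y)) ∧
        (∀ (f : Site d → 𝔸) (r : ℝ), 0 ≤ r → Bd2 L (ι j).η (ι j).k (ι j).Ω f r →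
          (∀ x, ‖g f x‖ ≤ BG * r) ∧ ∀ n, n ≤ (ι j).k → ∀ p ∈ {b : Site d × Fin d | SideTouches ((ι j).Ω n) b.1 b.2},
            wt L (ι j).η n * ‖covDerivFwd (ι j).η (ι j).U₀ p.2 (g f) p.1‖ ≤ BG * r) ∧
        (∀ (f : Site d → 𝔸) (r : ℝ), 0 ≤ r → Bd2 L (ι j).η (ι j).k (ι j).Ω f r →
          Bd2 L (ι j).η (ι j).k (ι j).Ω (f - g (qs (c (q (g f))))) (BR * r))) :
    B8.Prop5Unique (fun j : J => zdLan L B₁ (ι j)) := by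
  have hd1 : 1 ≤ d := le_trans (by norm_num) hd2
  have hL1 : 1 ≤ L := le_trans (by norm_num) hL
  have hLr : (1 : ℝ) ≤ L := by exact_mod_cast hL1
  have hL0 : (0 : ℝ) < L := by positivity
  have hdr : (1 : ℝ) ≤ d := by exact_mod_cast hd1
  haveI : Nontrivial (Fin d) := Fin.nontrivial_iff_two_le.mpr hd2
  -- the windows of n04-b at B₀ := max(B₁, 2)/(5dL): ONE contraction radius α₄, ONE socket radius c_u, ONE threshold c_P
  have hBp2 : (2 : ℝ) ≤ max B₁ 2 := le_max_right _ _
  have hBp0 : (0 : ℝ) < max B₁ 2 := by linarith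
  have h5 : (0 : ℝ) < 5 * (d : ℝ) * L := by positivity
  have hB₀ : (0 : ℝ) < max B₁ 2 / (5 * (d : ℝ) * L) := div_pos hBp0 h5
  have hBeq : 5 * (d : ℝ) * L * (max B₁ 2 / (5 * (d : ℝ) * L)) = max B₁ 2 := by field_simp
  have hB : (2 : ℝ) ≤ 5 * (d : ℝ) * L * (max B₁ 2 / (5 * (d : ℝ) * L)) := by rw [hBeq]; exact hBp2
  obtain ⟨α₄, cu, cP, hα₄, hcu, hcP, hwin⟩ := uniqWindows_of_guard (cB9 := 1) hd1 hL1 hB₀ hB hB₀'H hB₂' hBG hBR one_pos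
  unfold B8.Prop5Unique
  refine ⟨min cP cL, cu / L, lt_min hcP hcL, div_pos hcu hL0, ?_⟩
  intro j α₀ α₁ hα₀ hα₁ hs p hp l₁ l₂ hS₁ hS₂ hn₁ hn₂
  -- THE MEMBER
  have hη := (ι j).hη
  have hk := (ι j).hk
  have hU₀ := (ι j).hU₀
  have huniv : ∀ x, x ∈ (ι j).Ω 0 := fun x => by rw [hΩ0 j]; exact Set.mem_univ x
  have hsum : 0 < α₀ + α₁ := add_pos hα₀ hα₁
  -- the scales: c⋆ := max(B₁,2)(α₀+α₁), c_B = c_A := L·c⋆, c_DA := dL²·c⋆, α₃ := 40d·c_B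
  have hcs_eq : max B₁ 2 * (α₀ + α₁) = 5 * (d : ℝ) * L * (max B₁ 2 / (5 * (d : ℝ) * L)) * (α₀ + α₁) := by rw [hBeq]
  obtain ⟨-, -, -, -, -, -, hα3, hα4, -, -, -, hα₃', hs₁, hs₂, hs₃, hs₄, hs₅, hs₆, hs₇, hsm, hprod8, hcA', ha₁', hb₁', hθ, h103, h106, hlE, hcuw⟩ :=
    hwin α₀ α₁ hα₀ hα₁ (hs.trans (min_le_left _ _)) (max B₁ 2 * (α₀ + α₁)) _ _ _ _ _ _ hcs_eq rfl rfl rfl rfl rfl rfl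
  have hcs0 : 0 ≤ max B₁ 2 * (α₀ + α₁) := by positivity
  have hcB0 : 0 ≤ (L : ℝ) * (max B₁ 2 * (α₀ + α₁)) := by positivity
  have hcDA0 : 0 ≤ (d : ℝ) * (L : ℝ) ^ 2 * (max B₁ 2 * (α₀ + α₁)) := by positivity
  have hα₃0 : (0 : ℝ) ≤ 40 * d * ((L : ℝ) * (max B₁ 2 * (α₀ + α₁))) := by positivity
  have hC2 : 0 ≤ C2p d := B8Ineq125Concrete.C2p_nonneg d
  have hhE : 0 ≤ B₀'H * (C2p d * (40 * d * ((L : ℝ) * (max B₁ 2 * (α₀ + α₁))) + α₄) * α₄) := by positivity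
  -- the datum's constant `B₁(α₀+α₁)` lies below the scale `c⋆`; `c⋆ ≤ c_B ≤ 1/13`
  have hc1 : B₁ * (α₀ + α₁) ≤ max B₁ 2 * (α₀ + α₁) := mul_le_mul_of_nonneg_right (le_max_left _ _) hsum.le
  have hc10 : 0 ≤ B₁ * (α₀ + α₁) := by positivity
  have hcsB : max B₁ 2 * (α₀ + α₁) ≤ (L : ℝ) * (max B₁ 2 * (α₀ + α₁)) := le_mul_of_one_le_left hcs0 hLr
  have hcs13 : max B₁ 2 * (α₀ + α₁) ≤ 1 / 13 := hcsB.trans hcA'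
  -- the radius: c_u ≤ ¼α₄, 1/12, 1/70; c₃ = c_u/L ≤ c_u
  have hcu4 : cu ≤ α₄ / 4 := by linarith only [hcuw, hhE]
  have hcu12 : cu ≤ 1 / 12 := by linarith only [hcu4, ha₁', hhE]
  have hcu70 : cu ≤ 1 / 70 := by linarith only [hcu4, hb₁', hhE]
  have hcuL : cu / L ≤ cu := div_le_self hcu.le hLr
  -- THE DATUM `(u₁, A)`: (1.33), (1.69); (1.68) ⇒ (1.29); (1.73)/(1.74) ⇒ the Λ_j-witnesses at class constant α₃ = 40d·c_B
  have hp' := hp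
  obtain ⟨h33, h69, -, -⟩ := hp'
  have h33' : ∀ n, n ≤ (ι j).k → ∀ y ∈ (ι j).Λ n, pdevOn (tlo L y n) (thi L y n) (ι j).U₀ < α₀ * (((L : ℝ) ^ n)⁻¹) ^ 2 :=
    fun n hn y hy => pdevOn_tower_lt_of_inAk hL1 hα₀ h33 hn (htower j n hn y hy)
  have h69' : Cond169 L (ι j).k (ι j).η (ι j).Ω (ι j).U₀ p.1.2 (max B₁ 2 * (α₀ + α₁)) :=
    B8Eq178Averages.cond169_mono hη.le hc1 h69
  have hAd : ∀ n, n ≤ (ι j).k → ∀ x ∈ (ι j).Ω n, ∀ μ : Fin d,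
      wt L (ι j).η n * ‖p.1.2 x μ‖ ≤ (L : ℝ) * (max B₁ 2 * (α₀ + α₁)) ∧
        wt L (ι j).η n * ‖conjR ((ι j).U₀ (x - e μ) μ)⁻¹ (p.1.2 (x - e μ) μ)‖ ≤ (L : ℝ) * (max B₁ 2 * (α₀ + α₁)) :=
    hA_of_cond169 hL1 hη hk (hΩ j) hU₀ hcs0 h69'
  have hDA : Bd2 L (ι j).η (ι j).k (ι j).Ω (fun y => covDivB (ι j).η (ι j).U₀ p.1.2 y) ((d : ℝ) * (L : ℝ) ^ 2 * (max B₁ 2 * (α₀ + α₁))) :=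
    bd2_covDivB_of_cond169 hL1 hη hk (hΩ j) hU₀ hcs0 h69'
  have h129 : Restr129 L (ι j).k (ι j).Λ (ι j).U₀ p.1.1 := restr129_of_hyp169 hL1 B₁ (ι j) hp
  have hwit : ∀ n, n ≤ (ι j).k → ∀ y ∈ (ι j).Λ n, ∃ ut : Site d → 𝔸ˣ, (∀ x, ut x ∈ unitaryUnits 𝔸) ∧
      InLambda L (clampCfg (tlo L y n) (thi L y n) (ι j).U₀) ut n (40 * d * ((L : ℝ) * (max B₁ 2 * (α₀ + α₁)))) (((L : ℝ) ^ n)⁻¹) ∧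
      ∀ x : Site d, tlo L y n ≤ x → x ≤ thi L y n → p.1.1 x = ut x := by
    have hd0 : (0 : ℝ) ≤ d := by positivity
    have hdt : 0 ≤ (d : ℝ) * (max B₁ 2 * (α₀ + α₁)) := mul_nonneg hd0 hcs0
    have hdLt : 0 ≤ (d : ℝ) * ((L : ℝ) * (max B₁ 2 * (α₀ + α₁))) := mul_nonneg hd0 hcB0
    have ha : 16 * (d : ℝ) * B₁ * (α₀ + α₁) ≤ 40 * d * ((L : ℝ) * (max B₁ 2 * (α₀ + α₁))) :=
      calc 16 * (d : ℝ) * B₁ * (α₀ + α₁) = 16 * d * (B₁ * (α₀ + α₁)) := by ring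
        _ ≤ 16 * d * (max B₁ 2 * (α₀ + α₁)) := mul_le_mul_of_nonneg_left hc1 (by positivity)
        _ ≤ 40 * d * (max B₁ 2 * (α₀ + α₁)) := by linarith only [hdt]
        _ ≤ 40 * d * ((L : ℝ) * (max B₁ 2 * (α₀ + α₁))) := mul_le_mul_of_nonneg_left hcsB (by positivity)
    have hLb : (L : ℝ) * (4 * d * B₁ * (α₀ + α₁)) ≤ 40 * d * ((L : ℝ) * (max B₁ 2 * (α₀ + α₁))) := by
      have h2 : (L : ℝ) * (B₁ * (α₀ + α₁)) ≤ (L : ℝ) * (max B₁ 2 * (α₀ + α₁)) := mul_le_mul_of_nonneg_left hc1 hL0.le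
      calc (L : ℝ) * (4 * d * B₁ * (α₀ + α₁)) = 4 * d * ((L : ℝ) * (B₁ * (α₀ + α₁))) := by ring
        _ ≤ 4 * d * ((L : ℝ) * (max B₁ 2 * (α₀ + α₁))) := mul_le_mul_of_nonneg_left h2 (by positivity)
        _ ≤ 40 * d * ((L : ℝ) * (max B₁ 2 * (α₀ + α₁))) := by linarith only [hdLt]
    exact hwit_unitary_of_hyp169 hL1 hB₁ (ι j) hsum.le ha hLb hp
  -- THE LETTERS at (α₀, U₀); their `SideTouches`-laws restrict to the bonds touching `Ω_j`
  have hα₀L : α₀ ≤ cL := by linarith only [hs, min_le_right cP cL, hα₁]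
  obtain ⟨g, Δ, q, qs, Aw, c, H', g_leftB, c_left', hΔ, hqs, hq, hq0, hH0, hH1, hH2, hQH, hG, hRbd⟩ := SLetUB j α₀ hα₀ hα₀L h33
  have hbs : ∀ {S : Set (Site d)} {x : Site d} {μ : Fin d}, BondTouches S x μ → SideTouches S x μ := by
    intro S x μ hb
    obtain ⟨κ, hκ⟩ := exists_ne μ
    exact sideTouches_of_bondTouches hκ hb
  have hH1' : ∀ n, n ≤ (ι j).k → ∀ (X : XSpace d (ι j).k 𝔸), ∀ p ∈ {b : Site d × Fin d | BondTouches ((ι j).Ω n) b.1 b.2},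
      wt L (ι j).η n * ‖covDerivFwd (ι j).η (ι j).U₀ p.2 (H' X) p.1‖ ≤ B₀'H * ‖X‖ :=
    fun n hn X p hp => hH1 n hn X p (hbs hp)
  have hG' : ∀ (f : Site d → 𝔸) (r : ℝ), 0 ≤ r → Bd2 L (ι j).η (ι j).k (ι j).Ω f r →
      (∀ x, ‖g f x‖ ≤ BG * r) ∧ ∀ n, n ≤ (ι j).k → ∀ p ∈ {b : Site d × Fin d | BondTouches ((ι j).Ω n) b.1 b.2},
        wt L (ι j).η n * ‖covDerivFwd (ι j).η (ι j).U₀ p.2 (g f) p.1‖ ≤ BG * r :=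
    fun f r hr hf => ⟨(hG f r hr hf).1, fun n hn p hp => (hG f r hr hf).2 n hn p (hbs hp)⟩
  -- the bond classes `Eb j := {b ∣ b touches Ω_j}`
  have hEbΩ : ∀ n, n ≤ (ι j).k → ∀ x ∈ (ι j).Ω n, ∀ μ : Fin d, (x, μ) ∈ {b : Site d × Fin d | BondTouches ((ι j).Ω n) b.1 b.2} ∧
      (x - e μ, μ) ∈ {b : Site d × Fin d | BondTouches ((ι j).Ω n) b.1 b.2} :=
    fun n _ x hx μ => ⟨Or.inl hx, Or.inr (by show x - e μ + e μ ∈ (ι j).Ω n; rw [sub_add_cancel]; exact hx)⟩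
  have hEbT : ∀ n, n ≤ (ι j).k → ∀ y ∈ (ι j).Λ n, ∀ (x : Site d) (κ : Fin d), InBox (tlo L y n) (thi L y n) x →
      InBox (tlo L y n) (thi L y n) (x + e κ) → (x, κ) ∈ {b : Site d × Fin d | BondTouches ((ι j).Ω n) b.1 b.2} :=
    fun n hn y hy x κ hx _ => Or.inl (htower j n hn y hy x hx)
  -- `Ω_k ⊂ Ω_{k−1}`
  have hΩk : (ι j).Ω (ι j).k ⊆ (ι j).Ω ((ι j).k - 1) := by
    have h := hΩ j ((ι j).k - 1)
    rwa [Nat.sub_add_cancel hk] at h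
  -- EACH SOLUTION: the (1.109)-ball ⇒ the engine's radius c_u at k levels; (1.107)₁ ⇒ the multiplier clause by the D*-identity; (1.107)₂ verbatim
  have hsol : ∀ l : (zdLan L B₁ (ι j)).Lam, (zdLan L B₁ (ι j)).Solves p l → (zdLan L B₁ (ι j)).lamNorm l < cu / L →
      (∀ x, ‖l.1 x‖ ≤ cu) ∧
      (∀ n, n ≤ (ι j).k → ∀ b ∈ {b : Site d × Fin d | BondTouches ((ι j).Ω n) b.1 b.2},
        wt L (ι j).η n * ‖covDerivFwd (ι j).η (ι j).U₀ b.2 l.1 b.1‖ ≤ cu) ∧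
      (∃ μ : ℕ → Site d → 𝔸, ∀ x ∈ (ι j).Ω 0,
        covLap (ι j).η (ι j).U₀ (((ι j).Ω 0).indicator fun y => covDivB (ι j).η (ι j).U₀ p.1.2 y + covLap (ι j).η (ι j).U₀ l.1 y +
          ((conjR (gaugeExp l.1 y)⁻¹ (covDivB (ι j).η (ι j).U₀ p.1.2 y) - covDivB (ι j).η (ι j).U₀ p.1.2 y) +
            (gAd (covLap (ι j).η (ι j).U₀ l.1 y) (l.1 y) - covLap (ι j).η (ι j).U₀ l.1 y) +
              ∑ μ, frakF3 (ι j).η (ι j).U₀ l.1 p.1.2 y μ)) x = QT L (ι j).k (ι j).Λ (ι j).U₀ μ x) ∧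
      Restr129 L (ι j).k (ι j).Λ (ι j).U₀ (p.1.1 * gaugeExp l.1) := by
    intro l hS hn
    obtain ⟨hLan, hR⟩ := hS
    -- the dictionary (1.109) ⇒ pointwise, levels n ≤ k − 1
    have hpt := fun (n : ℕ) (hn' : n ≤ (ι j).k - 1) => norm_lt_of_lamNorm_lt L B₁ (ι j) hL1 l hn hn'
    have hl : ∀ x, ‖l.1 x‖ ≤ cu := fun x => ((hpt 0 (Nat.zero_le _)).1 x (huniv x)).le.trans hcuL
    have hDn : ∀ n, n ≤ (ι j).k - 1 → ∀ (x : Site d) (μ : Fin d), BondTouches ((ι j).Ω n) x μ →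
        wt L (ι j).η n * ‖covDerivFwd (ι j).η (ι j).U₀ μ l.1 x‖ ≤ cu / L := fun n hn' x μ hb => by
      unfold wt; exact ((hpt n hn').2 x μ hb).le
    have hD : ∀ n, n ≤ (ι j).k → ∀ b ∈ {b : Site d × Fin d | BondTouches ((ι j).Ω n) b.1 b.2},
        wt L (ι j).η n * ‖covDerivFwd (ι j).η (ι j).U₀ b.2 l.1 b.1‖ ≤ cu := by
      intro n hn' b hb
      rcases Nat.lt_or_ge n (ι j).k with hlt | hge
      · exact (hDn n (by omega) b.1 b.2 hb).trans hcuL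
      · obtain rfl : n = (ι j).k := le_antisymm hn' hge
        have hb' : BondTouches ((ι j).Ω ((ι j).k - 1)) b.1 b.2 := hb.imp (fun h => hΩk h) (fun h => hΩk h)
        have h := hDn ((ι j).k - 1) le_rfl b.1 b.2 hb'
        have hw : wt L (ι j).η (ι j).k = L * wt L (ι j).η ((ι j).k - 1) := by
          unfold wt
          rw [← mul_assoc, ← pow_succ', Nat.sub_add_cancel hk]
        have hwm : 0 ≤ wt L (ι j).η ((ι j).k - 1) := wt_nonneg L hη.le _
        rw [hw, mul_assoc]
        calc (L : ℝ) * (wt L (ι j).η ((ι j).k - 1) * ‖covDerivFwd (ι j).η (ι j).U₀ b.2 l.1 b.1‖) ≤ L * (cu / L) :=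
              mul_le_mul_of_nonneg_left h hL0.le
          _ = cu := by field_simp
    -- the multiplier clause from the Landau condition of record (the D*-identity read backwards, on Ω₀ = ℤᵈ)
    have hk0 : 0 < (ι j).k := hk
    have hmult : ∃ μ : ℕ → Site d → 𝔸, ∀ x ∈ (ι j).Ω 0,
        covLap (ι j).η (ι j).U₀ (((ι j).Ω 0).indicator fun y => covDivB (ι j).η (ι j).U₀ p.1.2 y + covLap (ι j).η (ι j).U₀ l.1 y +
          ((conjR (gaugeExp l.1 y)⁻¹ (covDivB (ι j).η (ι j).U₀ p.1.2 y) - covDivB (ι j).η (ι j).U₀ p.1.2 y) +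
            (gAd (covLap (ι j).η (ι j).U₀ l.1 y) (l.1 y) - covLap (ι j).η (ι j).U₀ l.1 y) +
              ∑ μ, frakF3 (ι j).η (ι j).U₀ l.1 p.1.2 y μ)) x = QT L (ι j).k (ι j).Λ (ι j).U₀ μ x := by
      obtain ⟨μ, hμ⟩ := hLan
      refine ⟨μ, fun x hx => ?_⟩
      have hind : (((ι j).Ω 0).indicator fun y => covDivB (ι j).η (ι j).U₀ p.1.2 y + covLap (ι j).η (ι j).U₀ l.1 y +
          ((conjR (gaugeExp l.1 y)⁻¹ (covDivB (ι j).η (ι j).U₀ p.1.2 y) - covDivB (ι j).η (ι j).U₀ p.1.2 y) +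
            (gAd (covLap (ι j).η (ι j).U₀ l.1 y) (l.1 y) - covLap (ι j).η (ι j).U₀ l.1 y) +
              ∑ μ, frakF3 (ι j).η (ι j).U₀ l.1 p.1.2 y μ)) =
          ((ι j).Ω 0).indicator (covDivB (ι j).η (ι j).U₀ (logCfg (ι j).η (mgauge (ι j).U₀ (gaugeExp l.1)⁻¹ (cfgExp (ι j).η p.1.2)))) := by
        refine Set.indicator_congr fun y _ => ?_
        have hly : ‖l.1 y‖ ≤ 1 / 12 := (hl y).trans hcu12
        have h0 := hpt 0 (Nat.zero_le _)
        have hDy : ∀ ν : Fin d, (ι j).η * ‖covDerivFwd (ι j).η (ι j).U₀ ν l.1 y‖ ≤ 1 / 70 := fun ν => by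
          have h := (h0.2 y ν (Or.inl (huniv y))).le
          rw [pow_zero, one_mul] at h
          exact h.trans (hcuL.trans hcu70)
        have hay : ∀ ν : Fin d, (ι j).η * ‖covDeriv (ι j).η (ι j).U₀ ν l.1 y‖ ≤ 1 / 70 := fun ν => by
          rw [norm_covDeriv_eq hU₀]
          have h := (h0.2 (y - e ν) ν (Or.inl (huniv _))).le
          rw [pow_zero, one_mul] at h
          exact h.trans (hcuL.trans hcu70)
        have hYy : ∀ ν : Fin d, (ι j).η * ‖conjR ((ι j).U₀ (y - e ν) ν)⁻¹ (p.1.2 (y - e ν) ν)‖ ≤ 1 / 12 := fun ν => by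
          have hu : (((ι j).U₀ (y - e ν) ν)⁻¹ : 𝔸ˣ) ∈ U1 𝔸 := (U1 𝔸).inv_mem (unitaryUnits_le_U1 (hU₀ _ ν))
          rw [norm_conjR hu]
          have hA := ((h69' 0 hk0 (y - e ν) ν (Or.inl (huniv _))).1).le
          rw [pow_zero, one_mul] at hA
          calc (ι j).η * ‖p.1.2 (y - e ν) ν‖ ≤ (ι j).η * (max B₁ 2 * (α₀ + α₁) * (ι j).η⁻¹) := mul_le_mul_of_nonneg_left hA hη.le
            _ = max B₁ 2 * (α₀ + α₁) := by field_simp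
            _ ≤ 1 / 12 := by linarith only [hcs13]
        exact (covDivB_logCfg_gaugeFixed hη (ι j).U₀ p.1.2 hly hDy hay hYy).symm
      rw [hind]
      exact hμ x hx
    exact ⟨hl, hD, hmult, hR⟩
  obtain ⟨hl₁, hD₁, hmult₁, hR₁⟩ := hsol l₁ hS₁ hn₁
  obtain ⟨hl₂, hD₂, hmult₂, hR₂⟩ := hsol l₂ hS₂ hn₂
  -- THE UNIQUENESS JOIN AT PRINT'S GENERALITY (`hFP_unique_of_sectE_local_wb`, BY NAME) at ρ := c_u, α₃ := 40d·c_B, c_A := c_B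
  have heq : l₁.1 = l₂.1 := hFP_unique_of_sectE_local_wb (Ω := (ι j).Ω) (Λs := (ι j).Λ)
    (Eb := fun n => {b : Site d × Fin d | BondTouches ((ι j).Ω n) b.1 b.2}) (u₁ := p.1.1) (A := p.1.2) hL hη hU₀ (hΩ0 j) hEbΩ hEbT g Δ q qs Aw c
    g_leftB c_left' hΔ hqs hq hq0 H' hα₀ hα3 hα4 hα₃0 hα₄ hB₀'H hB₂' h33' hwit h129 hH0 hH1' hH2 hQH hα₃' hs₁ hs₂ hs₃ hs₄ hs₅ hs₆ hs₇ hsm hprod8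
    rfl rfl rfl rfl hBG hBR hcB0 hcA' hcDA0 ha₁' hb₁' hθ hlE hcuw hG' hRbd hDA hAd h103 h106 hl₁ hD₁ hmult₁ hR₁ hl₂ hD₂ hmult₂ hR₂
  exact Subtype.ext heq

end Main

#print axioms hwit_unitary_of_hyp169
#print axioms prop5Unique_zdLan_of_lettersUB

end Literature.MathematicalPhysics.QuantumFieldTheory.Balaban1983to89.B8Prop5UniqueZdLan

end
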